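import Summits.CriticalPhenomena.SAWScalingLimit.Theorems.SAWWeldingIdentificationRemovableLimitUpToKappa
import HarnessLib

/-!
# `RemovableLimit` ⟸ [some SLE_κ law] ∧ stmt-4982 ∧ [SLE₄ trace removable in `ℍ`] — the domain transfer

Route `SAWWeldingIdentification` of `CriticalPhenomena/SAWScalingLimit`, crux (R) `RemovableLimit`
(stmt-CriticalPhenomena-4503), line `registered`, skeleton v5 (lead c12): registered stub **T5
`stub_sleFourDomainTransfer`**, proved here by name and signature, plus the compositions it feeds.

Skeleton v4 (lead c11, `Theorems/SAWWeldingIdentificationRemovableLimitUpToKappa.lean`) proved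
(R) ⟸ S0a ∧ S1 with S0a = "every subsequential weak limit of the critical SAW laws in
`(Q; a_δ, b_δ)` is a chordal SLE_κ law for SOME `κ > 0`, **`κ ≠ 4`**" and S1 = `SimpleSubseqLimits`
(stmt-4982). The side condition `κ ≠ 4` stands in for the conformal removability of SLE₄ (which
Rohde–Schramm's Hölder-domain theorem, Thm 5.2, `κ ≠ 4`, does not give); c11 isolated the missing
input as the hypothesis `h3` of `removableLimit_of_someSLELaw_of_simpleSubseqLimits_of_sleFourRemovable`
— "every chordal SLE₄ random curve in a Dobrushin domain has a.s. conformally removable trace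
INSIDE the domain", in the tree's into-`ℂ` sense `IsConformallyRemovableIn`.

That input is Kavvadias–Miller–Schoug's theorem (arXiv:2209.10532): the PROOF of their Thm 1.1
(p. 61: "`η` satisfies the conditions of Theorem 8.1 a.s.") goes through their Thm 8.1 (p. 62),
whose conclusion — "if `f : D → ℂ` is a homeomorphism onto its image and conformal on `D ∖ X` then
`f` is conformal on `D`", `D = ℍ`, `X` = range of the SLE₄ trace — is verbatim
`IsConformallyRemovableIn ℍ (range η)`. In this file that statement is an explicit HYPOTHESIS
`hK : ∀ᵐ ω ∂preWienerMeasure, IsConformallyRemovableIn ℍ (range (sleTrace 4 ω))` (the registered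
literature stub T3 `stub_sleFourTraceRemovable` of the skeleton; filed as the Literature named fact
`KavvadiasMillerSchoug2022_thm11`, `Literature/Probability/RandomPlanarGeometry/SLEFourRemovability.lean`),
and everything downstream of it is PROVED:

* `isConformallyRemovableIn_range_of_isCompactifiedImage_of_trace` — deterministic transfer: if a
  simple trace `γ` in `ℍ` has removable range inside `ℍ`, then its time-compactified image under
  the boundary extension of a conformal equivalence `φ : ℍ → D` has removable range inside
  `D.carrier` (conformal invariance `IsConformallyRemovableIn.image_conformalEquiv`; the points of
  the compactified curve inside the open carrier are `φ(γ(t))`, `t > 0`).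
* `stub_sleFourDomainTransfer` (**T5, registered signature**) — `hK` ⟹ c11's hypothesis `h3`:
  every chordal SLE₄ random curve in a Dobrushin domain has a.s. removable trace inside the domain
  (Rohde–Schramm Thm 6.1 for the simplicity of the trace, proved in the tree). This is the
  "arbitrary simply connected domain" remark after KMS Thm 1.1, done along the chordal uniformiser.
* `ae_isConformallyRemovableIn_of_isSLELaw_of_le_four_of_trace` — hence (`hK`) every chordal SLE_κ
  LAW with `0 < κ ≤ 4` is carried by curve classes with removable trace (`κ < 4`: c5's
  `ae_isConformallyRemovableIn_of_isSLELaw`; `κ = 4`: c11's law-side transfer through the analytic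
  bad set, `ae_isConformallyRemovableIn_of_isSLELaw_four`).
* `removableLimit_of_someSLELaw_of_simpleSubseqLimits_of_trace` — **(R) ⟸ T3 ∧ S0b ∧ S1** with
  S0b = "every subsequential SAW limit in `(Q; a_δ, b_δ)` is a chordal SLE_κ law in `Q.chord 0 2`
  for SOME `κ > 0`" (NO side condition), S1 = stmt-4982;
  `removableLimit_of_identificationUpToKappa_of_simpleSubseqLimits_of_trace` — the same with S0b
  replaced by the registered dock stub `stub_identificationUpToKappa` of the stmt-0783 chain, quoted
  verbatim (through c11's `someSLELaw_of_identificationUpToKappa`).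

So, kernel-exactly and modulo ONE published theorem (KMS 2022, hypothesis `hK`), the crux (R) is the
conjunction of two statements that are each a registered stub of ANOTHER live chain: identification
of subsequential SAW limits up to the value of `κ` (stmt-0783 dock) and their simplicity (stmt-4982).

References: K. Kavvadias, J. Miller, L. Schoug, *Conformal removability of SLE₄*,
arXiv:2209.10532 v1 (2022), Thm 1.1 (p. 3), Thm 8.1 (p. 62), proof of Thm 1.1 (p. 61)
[`KavvadiasMillerSchoug2022`]; [RohdeSchramm2005] Thm 5.2, Thm 6.1; [JonesSmirnov2000] Def. 1,
Cor. 2; [Lawler2005] §6.3.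
-/

noncomputable section

open MeasureTheory Filter Set Metric
open scoped Topology NNReal unitInterval
open UpperHalfPlane (upperHalfPlaneSet isOpen_upperHalfPlaneSet)
open Literature.Probability.RandomPlanarGeometry Literature.Probability.LatticeModels
open Literature.Probability.Process (preWienerMeasure)
open Summit.CriticalPhenomena.SAWScalingLimit.Theses

namespace Summit.CriticalPhenomena.SAWScalingLimit.Theorems.RemovableLimit

/-! ### 1. Deterministic transfer from `ℍ` to a Dobrushin domain -/

/-- **Removability of the compactified image of a removable simple trace.** Let `γ : [0, ∞) → ℂ`
be a simple trace (injective, in `ℍ` for positive times) whose range is conformally removable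
inside `ℍ`; let `φ : ℍ → D.carrier` be a conformal equivalence onto a Dobrushin domain whose
boundary extension sends `γ 0` off `D.carrier`, and let `c` be the time-compactified image of `γ`
under that boundary extension, ending at `b = D.pt 1`. Then the range of `c` is conformally
removable inside `D.carrier`: its part inside the (open) carrier consists of the points
`φ(γ(t))`, `t > 0`, so it lies in `φ(range γ ∩ ℍ)`, which is removable inside `D.carrier` by the
conformal invariance of removability (`IsConformallyRemovableIn.image_conformalEquiv`), and subsets
of removable sets are removable. [folklore] -/
theorem isConformallyRemovableIn_range_of_isCompactifiedImage_of_trace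
    {γ : ℝ≥0 → ℂ} (hs : Loewner.IsSimpleTrace γ)
    (hrem : IsConformallyRemovableIn upperHalfPlaneSet (range γ))
    (D : DobrushinDomain) (φ : ConformalEquiv upperHalfPlaneSet D.carrier)
    (ha : φ.boundaryExtension (γ 0) ∉ D.carrier) {c : Curve ℂ}
    (hc : IsCompactifiedImage φ.boundaryExtension γ (D.pt 1) c) :
    IsConformallyRemovableIn D.carrier c.range := by
  have hDo : IsOpen D.carrier := D.isOpen
  have hb : D.pt 1 ∉ D.carrier := fun h =>
    (D.pt_mem_frontier 1).2 (by rwa [hDo.interior_eq])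
  have himg := hrem.image_conformalEquiv φ
  rw [IsConformallyRemovableIn.iff_inter]
  refine himg.anti ?_
  rintro _ ⟨⟨s, rfl⟩, hsD⟩
  have hs1 : (s : ℝ) < 1 := by
    by_contra h
    rw [unitInterval.eq_one_of_not_lt h, hc.2] at hsD
    exact hb hsD
  have hcs : c s = φ.boundaryExtension (γ (rayParam s)) := hc.1 s hs1
  have h0 : 0 < rayParam s := by
    rcases eq_or_ne (rayParam s) 0 with h | h
    · rw [hcs, h] at hsD
      exact absurd hsD ha
    · exact pos_iff_ne_zero.2 h
  have hH : γ (rayParam s) ∈ upperHalfPlaneSet := hs.2 _ h0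
  refine ⟨γ (rayParam s), ⟨⟨rayParam s, rfl⟩, hH⟩, ?_⟩
  rw [hcs, φ.boundaryExtension_eq hH]

/-! ### 2. T5: removability in `ℍ` ⟹ removability inside every Dobrushin domain -/

/-- **T5 `stub_sleFourDomainTransfer` of skeleton v5 of crux stmt-CriticalPhenomena-4503, by name
and signature — SLE₄ curves in a Dobrushin domain have a.s. removable trace.** IF almost surely the
range of the SLE₄ trace `sleTrace 4 ω` is conformally removable inside `ℍ` (Kavvadias–Miller–Schoug
2022, Thm 1.1 through their Thm 8.1 — the registered literature stub T3, named fact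
`KavvadiasMillerSchoug2022_thm11`), THEN for every chordal SLE₄ random curve `Γ` in a Dobrushin
domain `D` (`IsSLECurve 4 D Γ`: a.s. the class of the time-compactified image of the SLE₄ trace
under the boundary extension of a chordal uniformizing map `φ : ℍ → D`), almost surely the trace of
`Γ ω` is conformally removable inside `D.carrier`. The trace is a.s. simple (Rohde–Schramm 2005
Thm 6.1, `ae_isSimpleTrace_sleTrace_of_le_four_holds`), `φ̄(γ 0) = φ̄(0) = D.pt 0` lies on the
frontier, and the deterministic transfer
`isConformallyRemovableIn_range_of_isCompactifiedImage_of_trace` applies. (The "arbitrary simply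
connected domain" remark after KMS Thm 1.1.)
[cite: KavvadiasMillerSchoug2022, Thm 1.1 and the remark following it (p. 3); RohdeSchramm2005, Thm 6.1] -/
theorem stub_sleFourDomainTransfer :
    (∀ᵐ ω ∂preWienerMeasure, IsConformallyRemovableIn upperHalfPlaneSet (range (sleTrace 4 ω))) →
    ∀ (D : DobrushinDomain) (Γ : (ℝ≥0 → ℝ) → CurveClass ℂ), IsSLECurve 4 D Γ →
    ∀ᵐ ω ∂preWienerMeasure, IsConformallyRemovableIn D.carrier (Γ ω).range := by
  intro hK D Γ hΓ
  obtain ⟨-, φ, hφ, hae⟩ := hΓ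
  have hsimple : ∀ᵐ ω ∂preWienerMeasure, Loewner.IsSimpleTrace (sleTrace 4 ω) :=
    ae_isSimpleTrace_sleTrace_of_le_four_holds (by norm_num) le_rfl
  filter_upwards [hae, hsimple, hK] with ω hω hs hrem
  obtain ⟨-, c, hΓω, hc⟩ := hω
  have hrange : (Γ ω).range = c.range := by rw [hΓω, CurveClass.range_mk]
  have ha : φ.boundaryExtension (sleTrace 4 ω 0) ∉ D.carrier := by
    rw [sleTrace_zero, hφ.boundaryExtension_zero]
    exact fun h => (D.pt_mem_frontier 0).2 (by rwa [D.isOpen.interior_eq])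
  rw [hrange]
  exact isConformallyRemovableIn_range_of_isCompactifiedImage_of_trace hs hrem D φ ha hc

/-! ### 3. Law-level consequences -/

/-- **Every chordal SLE₄ LAW is carried by classes with removable trace** (from the `ℍ`-removability
of the trace, hypothesis `hK`): c11's law-side transfer `ae_isConformallyRemovableIn_of_isSLELaw_four`
(the bad set is analytic, hence null for the law once a.s. avoided) fed with T5.
[cite: KavvadiasMillerSchoug2022, Thm 1.1] -/
theorem ae_isConformallyRemovableIn_of_isSLELaw_four_of_trace
    (hK : ∀ᵐ ω ∂preWienerMeasure, IsConformallyRemovableIn upperHalfPlaneSet (range (sleTrace 4 ω)))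
    {D : DobrushinDomain} {P : Measure (CurveClass ℂ)} (h : IsSLELaw 4 D P) :
    ∀ᵐ γ ∂P, IsConformallyRemovableIn D.carrier γ.range :=
  ae_isConformallyRemovableIn_of_isSLELaw_four (stub_sleFourDomainTransfer hK) h

/-- **Removability of simple-phase SLE laws, `0 < κ ≤ 4`** (the corner `κ = 4` from the
`ℍ`-removability of the SLE₄ trace, hypothesis `hK`): every chordal SLE_κ law in a Dobrushin domain
with `0 < κ ≤ 4` is carried by curve classes whose trace is conformally removable inside the
domain — Rohde–Schramm Thm 5.2 + Jones–Smirnov Cor. 2 for `κ < 4`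
(`ae_isConformallyRemovableIn_of_isSLELaw`, proved in the tree) and Kavvadias–Miller–Schoug for
`κ = 4`. [cite: KavvadiasMillerSchoug2022, Thm 1.1; RohdeSchramm2005, Thm 5.2] -/
theorem ae_isConformallyRemovableIn_of_isSLELaw_of_le_four_of_trace
    (hK : ∀ᵐ ω ∂preWienerMeasure, IsConformallyRemovableIn upperHalfPlaneSet (range (sleTrace 4 ω)))
    {κ : ℝ≥0} (h0 : 0 < κ) (h4 : κ ≤ 4) {D : DobrushinDomain} {P : Measure (CurveClass ℂ)}
    (h : IsSLELaw κ D P) : ∀ᵐ γ ∂P, IsConformallyRemovableIn D.carrier γ.range := by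
  rcases h4.lt_or_eq with hlt | rfl
  · exact ae_isConformallyRemovableIn_of_isSLELaw h0 hlt h
  · exact ae_isConformallyRemovableIn_of_isSLELaw_four_of_trace hK h

/-! ### 4. The compositions: (R) with no side condition on `κ` -/

/-- **(R) ⟸ [SLE₄ trace removable in `ℍ`] ∧ "some SLE_κ law" ∧ stmt-4982.** If (T3, `hK`) the SLE₄
trace is a.s. conformally removable inside `ℍ` (Kavvadias–Miller–Schoug), (S0b, `h0`) every
subsequential weak limit `P` of the critical SAW laws in `(Q; a_δ, b_δ)` is a chordal SLE_κ law in
`Q.chord 0 2` for SOME `κ > 0`, and (S1, `h1`) every subsequential limit is carried by simple chords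
(`SimpleSubseqLimits`, stmt-CriticalPhenomena-4982), then `RemovableLimit` holds: simplicity pins
`κ ≤ 4` (`kappa_le_four_of_isSLELaw_of_ae_mem_simple`), and simple-phase SLE laws are carried by
removable curves. This is c11's `removableLimit_of_someSLELaw_of_simpleSubseqLimits_of_sleFourRemovable`
with its third hypothesis discharged by T5. [cite: KavvadiasMillerSchoug2022, Thm 1.1] -/
theorem removableLimit_of_someSLELaw_of_simpleSubseqLimits_of_trace
    (hK : ∀ᵐ ω ∂preWienerMeasure, IsConformallyRemovableIn upperHalfPlaneSet (range (sleTrace 4 ω)))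
    (h0 : ∀ (Q : ConformalRectangle) (a b : ℝ → Site 2),
      SAW.IsEndpointApprox (Q.chord 0 2 (by decide)) a b →
      ∀ (P : Measure (CurveClass ℂ)), IsProbabilityMeasure P → ∀ (δs : ℕ → ℝ), (∀ n, 0 < δs n) →
      Tendsto δs atTop (𝓝 0) →
      (∀ f : BoundedContinuousFunction (CurveClass ℂ) ℝ,
        Tendsto (fun n => ∫ γ, f γ.curve ∂(SAW.law Q.carrier (δs n) (a (δs n)) (b (δs n)))) atTop
          (𝓝 (∫ γ, f γ ∂P))) →
      ∃ κ : ℝ≥0, 0 < κ ∧ IsSLELaw κ (Q.chord 0 2 (by decide)) P)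
    (h1 : SAWLoopFugacityFlow.SimpleSubseqLimits) :
    SAWWeldingIdentification.RemovableLimit :=
  removableLimit_of_someSLELaw_of_simpleSubseqLimits_of_sleFourRemovable h0 h1
    (stub_sleFourDomainTransfer hK)

/-- **(R) ⟸ [SLE₄ trace removable in `ℍ`] ∧ [stmt-0783 dock stub] ∧ stmt-4982.** The identification
input in the SHARED currency of the stmt-CriticalPhenomena-0783 chain: its registered dock stub
`stub_identificationUpToKappa` (line `boundary-area-law`: along every mesh sequence `s_n → 0⁺` ONE
`κ > 0` identifies every subsequential SAW limit in every Dobrushin domain as a chordal SLE_κ law),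
quoted verbatim as `hdock`, gives S0b (`someSLELaw_of_identificationUpToKappa`), hence, with
simplicity (stmt-4982) and Kavvadias–Miller–Schoug, the crux. [cite: KavvadiasMillerSchoug2022, Thm 1.1] -/
theorem removableLimit_of_identificationUpToKappa_of_simpleSubseqLimits_of_trace
    (hK : ∀ᵐ ω ∂preWienerMeasure, IsConformallyRemovableIn upperHalfPlaneSet (range (sleTrace 4 ω)))
    (hdock : ∀ (s : ℕ → ℝ), Tendsto s atTop (𝓝[>] (0 : ℝ)) → ∃ κ : ℝ≥0, 0 < κ ∧
      ∀ (D : DobrushinDomain) (a b : ℝ → Site 2), SAW.IsEndpointApprox D a b →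
      ∀ (μ : Measure (CurveClass ℂ)), IsProbabilityMeasure μ →
      (∀ f : BoundedContinuousFunction (CurveClass ℂ) ℝ,
        Tendsto (fun n => ∫ γ, f γ.curve ∂(SAW.law D.carrier (s n) (a (s n)) (b (s n)))) atTop
          (𝓝 (∫ x, f x ∂μ))) →
      IsSLELaw κ D μ)
    (h1 : SAWLoopFugacityFlow.SimpleSubseqLimits) :
    SAWWeldingIdentification.RemovableLimit :=
  removableLimit_of_someSLELaw_of_simpleSubseqLimits_of_trace hK
    (someSLELaw_of_identificationUpToKappa hdock) h1

/-- **S0b from the v4 stub S0a** (drop the clause `κ ≠ 4`): the v5 identification stub is weaker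
than the v4 one, so everything that implied S0a (stmt-0783, stmt-4502, the summit:
`sleSubseqLimitUpToKappa_of_subseqIdentification`, `sleSubseqLimitUpToKappa_of_weldingLawOfLimit`)
implies S0b. [folklore] -/
theorem someSLELaw_of_sleSubseqLimitUpToKappa
    (h0a : ∀ (Q : ConformalRectangle) (a b : ℝ → Site 2),
      SAW.IsEndpointApprox (Q.chord 0 2 (by decide)) a b →
      ∀ (P : Measure (CurveClass ℂ)), IsProbabilityMeasure P → ∀ (δs : ℕ → ℝ), (∀ n, 0 < δs n) →
      Tendsto δs atTop (𝓝 0) →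
      (∀ f : BoundedContinuousFunction (CurveClass ℂ) ℝ,
        Tendsto (fun n => ∫ γ, f γ.curve ∂(SAW.law Q.carrier (δs n) (a (δs n)) (b (δs n)))) atTop
          (𝓝 (∫ γ, f γ ∂P))) →
      ∃ κ : ℝ≥0, 0 < κ ∧ κ ≠ 4 ∧ IsSLELaw κ (Q.chord 0 2 (by decide)) P) :
    ∀ (Q : ConformalRectangle) (a b : ℝ → Site 2),
      SAW.IsEndpointApprox (Q.chord 0 2 (by decide)) a b →
      ∀ (P : Measure (CurveClass ℂ)), IsProbabilityMeasure P → ∀ (δs : ℕ → ℝ), (∀ n, 0 < δs n) →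
      Tendsto δs atTop (𝓝 0) →
      (∀ f : BoundedContinuousFunction (CurveClass ℂ) ℝ,
        Tendsto (fun n => ∫ γ, f γ.curve ∂(SAW.law Q.carrier (δs n) (a (δs n)) (b (δs n)))) atTop
          (𝓝 (∫ γ, f γ ∂P))) →
      ∃ κ : ℝ≥0, 0 < κ ∧ IsSLELaw κ (Q.chord 0 2 (by decide)) P := by
  intro Q a b hab P hP δs hpos hδ hlim
  obtain ⟨κ, hκ0, -, hSLE⟩ := h0a Q a b hab P hP δs hpos hδ hlim
  exact ⟨κ, hκ0, hSLE⟩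

/-- **S0b from this route's crux (W)** (stmt-4502): `WeldingLawOfLimit` identifies every
subsequential limit as THE SLE₈/₃ law (`isSLELaw_of_weldingLawOfLimit`, p145305). [folklore] -/
theorem someSLELaw_of_weldingLawOfLimit (hW : SAWWeldingIdentification.WeldingLawOfLimit) :
    ∀ (Q : ConformalRectangle) (a b : ℝ → Site 2),
      SAW.IsEndpointApprox (Q.chord 0 2 (by decide)) a b →
      ∀ (P : Measure (CurveClass ℂ)), IsProbabilityMeasure P → ∀ (δs : ℕ → ℝ), (∀ n, 0 < δs n) →
      Tendsto δs atTop (𝓝 0) →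
      (∀ f : BoundedContinuousFunction (CurveClass ℂ) ℝ,
        Tendsto (fun n => ∫ γ, f γ.curve ∂(SAW.law Q.carrier (δs n) (a (δs n)) (b (δs n)))) atTop
          (𝓝 (∫ γ, f γ ∂P))) →
      ∃ κ : ℝ≥0, 0 < κ ∧ IsSLELaw κ (Q.chord 0 2 (by decide)) P :=
  someSLELaw_of_sleSubseqLimitUpToKappa (sleSubseqLimitUpToKappa_of_weldingLawOfLimit hW)

/-- **S0b from the shared crux stmt-0783** (`SubseqIdentification`). [folklore] -/
theorem someSLELaw_of_subseqIdentification (hI : SAWLoopFugacityFlow.SubseqIdentification) :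
    ∀ (Q : ConformalRectangle) (a b : ℝ → Site 2),
      SAW.IsEndpointApprox (Q.chord 0 2 (by decide)) a b →
      ∀ (P : Measure (CurveClass ℂ)), IsProbabilityMeasure P → ∀ (δs : ℕ → ℝ), (∀ n, 0 < δs n) →
      Tendsto δs atTop (𝓝 0) →
      (∀ f : BoundedContinuousFunction (CurveClass ℂ) ℝ,
        Tendsto (fun n => ∫ γ, f γ.curve ∂(SAW.law Q.carrier (δs n) (a (δs n)) (b (δs n)))) atTop
          (𝓝 (∫ γ, f γ ∂P))) →
      ∃ κ : ℝ≥0, 0 < κ ∧ IsSLELaw κ (Q.chord 0 2 (by decide)) P :=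
  someSLELaw_of_sleSubseqLimitUpToKappa (sleSubseqLimitUpToKappa_of_subseqIdentification hI)

end Summit.CriticalPhenomena.SAWScalingLimit.Theorems.RemovableLimit

end
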